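import Summits.Ventures.HodgeRepro.Tier4.Line1.LocalWittPlace
import Summits.Ventures.HodgeRepro.Tier4.Line1.C7LocalWitt
import Summits.Ventures.HodgeRepro.Tier4.Line1.C7Assembly
import Summits.Ventures.HodgeRepro.Tier4.Line1.C7CompactBox
import Summits.Ventures.HodgeRepro.Tier4.Line1.C7Reconstruct

/-!
# Tier4/Line1/C7LocalFibration — LINE L1: C7.1 and C7.1∞ as THEOREMS, and C7 modulo C7.2 alone

Blind re-derivation cell `pub-hodge-repro`, Tier 4 (README §9–§10), seat t4-L1-p4 (g2), LINE L1, rung C7 of the R-c cut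
(typed census proofs/t4/L1/C7-rungs-sig.lean; lead g385 R-II S12860 / S13015).  The two local walls of the census close
BY NAME:

* `exists_compact_local_stab_mul_fin` (C7.1, census L115–L121 VERBATIM) and `exists_compact_local_stab_mul_inf` (C7.1∞,
  census L125–L134 VERBATIM) = t4-L1-p2's `exists_compact_local_stab_mul_fin_of_witt` / `…_inf_of_witt` (C7LocalWitt
  p673752: t4-L1-p1's open-mapping fibration `exists_compact_stab_mul_of_transitive`, LocalFibration p672938, with the
  LocalFieldTopology instances) with their displayed local-Witt hypothesis `hwitt` DISCHARGED by
  `exists_mem_localU_vecMul_eq` / `exists_mem_localUInf_vecMul_eq` (LocalWittPlace — the field-generic Witt theorem of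
  LocalWitt p674173 at `k_v` / `k_w`).  No printed input remains in C7.1 / C7.1∞.
* `exists_compact_stab_mul_of_integral` (C7 modulo C7.2): C7Assembly's `exists_compact_stab_mul_of_rungs'` (p672987) with
  `h1`, `h1'` the theorems above, `h3a` = t4-L1-p2's `exists_finset_subset_box` (C7CompactBox p673043), `h3c` =
  `exists_GA_of_local` (C7Reconstruct p673045); the ONE remaining displayed hypothesis is C7.2, the integral
  transitivity at almost all finite places (census L139–L146; t4-L1-p1 g2 holds it, S13090).

Nothing here says anything about the status of the Hodge conjecture for CM abelian varieties, which is NOT proved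
(HC_CM is NOT proved by anyone in this repository).
-/

set_option autoImplicit false

noncomputable section

namespace Summit.Ventures.HodgeRepro.Tier4.Line1

open NumberField IsDedekindDomain HeightOneSpectrum Topology Summit.Ventures.HodgeRepro.Tier4.Common Matrix

section C7LocalFibration

variable {k : Type} [Field k] [NumberField k] (W : PlaneData k)

/-- **(C7.1) LOCAL FIBRATION AT A FINITE PLACE** (census L115–L121 verbatim, now a theorem): for a genuine definite
plane, a non-zero rational `v₀` and a compact `C ⊆ k_v⁴`, the set `{h ∈ U(W)(k_v) : v₀ h ∈ C}` is contained in
`Stab_v(v₀) · K` with `K` compact.  `= exists_compact_local_stab_mul_fin_of_witt` with `hwitt := exists_mem_localU_vecMul_eq`. -/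
theorem exists_compact_local_stab_mul_fin (hg : IsGenuineRow W) (hW : IsDefinite W)
    (v : HeightOneSpectrum (𝓞 k)) (v₀ : Fin 4 → k) (hv₀ : v₀ ≠ 0)
    {C : Set (Fin 4 → v.adicCompletion k)} (hC : IsCompact C) :
    ∃ K : Set (Matrix (Fin 4) (Fin 4) (v.adicCompletion k)), IsCompact K ∧
      ∀ h ∈ localU W v, finRat v v₀ ᵥ* h ∈ C →
        ∃ s ∈ localU W v, finRat v v₀ ᵥ* s = finRat v v₀ ∧ ∃ κ ∈ localU W v, κ ∈ K ∧ h = s * κ :=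
  exists_compact_local_stab_mul_fin_of_witt W hW v v₀
    (fun x h1 h2 => exists_mem_localU_vecMul_eq W hg hW v hv₀ x h1 h2) hC

/-- **(C7.1∞) LOCAL FIBRATION AT AN INFINITE PLACE** (census L125–L134 verbatim, now a theorem): the same over `k_w`.
`= exists_compact_local_stab_mul_inf_of_witt` with `hwitt := exists_mem_localUInf_vecMul_eq`. -/
theorem exists_compact_local_stab_mul_inf (hg : IsGenuineRow W) (hW : IsDefinite W)
    (w : InfinitePlace k) (v₀ : Fin 4 → k) (hv₀ : v₀ ≠ 0)
    {C : Set (Fin 4 → w.Completion)} (hC : IsCompact C) :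
    ∃ K : Set (Matrix (Fin 4) (Fin 4) w.Completion), IsCompact K ∧
      ∀ h ∈ localUInf W w, infRat w v₀ ᵥ* h ∈ C →
        ∃ s ∈ localUInf W w, infRat w v₀ ᵥ* s = infRat w v₀ ∧
          ∃ κ ∈ localUInf W w, κ ∈ K ∧ h = s * κ :=
  exists_compact_local_stab_mul_inf_of_witt W hW w v₀
    (fun x h1 h2 => exists_mem_localUInf_vecMul_eq W hg hW w hv₀ x h1 h2) hC

/-- **(C7 modulo C7.2) THE FIBRATION OVER THE STABILISER** with the integral transitivity at almost all finite places
(C7.2, census L139–L146) as its ONLY displayed hypothesis: `exists_compact_stab_mul_of_rungs'` (C7Assembly) with C7.1,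
C7.1∞, C7.3a, C7.3c supplied by name. -/
theorem exists_compact_stab_mul_of_integral (hg : IsGenuineRow W) (hW : IsDefinite W)
    (h2 : ∀ v₀ : Fin 4 → k, v₀ ≠ 0 → ∃ S₀ : Finset (HeightOneSpectrum (𝓞 k)), ∀ v ∉ S₀, ∀ h ∈ localU W v,
      (∀ i, (finRat v v₀ ᵥ* h) i ∈ v.adicCompletionIntegers k) →
        ∃ κ ∈ localUInt W v, finRat v v₀ ᵥ* κ = finRat v v₀ ᵥ* h)
    (v₀ : Fin 4 → k) (hv₀ : v₀ ≠ 0) {C₀ : Set (Fin 4 → Ad k)} (hC₀ : IsCompact C₀) :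
    ∃ K : Set (GA W), IsCompact K ∧ ∀ g : GA W,
      (fun i => algebraMap k (Ad k) (v₀ i)) ᵥ* GA.mat W g ∈ C₀ →
        ∃ s : GA W, (fun i => algebraMap k (Ad k) (v₀ i)) ᵥ* GA.mat W s =
          (fun i => algebraMap k (Ad k) (v₀ i)) ∧ ∃ κ ∈ K, g = s * κ :=
  exists_compact_stab_mul_of_rungs' W hW
    (fun v v₀ hv₀ _ hC => exists_compact_local_stab_mul_fin W hg hW v v₀ hv₀ hC)
    (fun w v₀ hv₀ _ hC => exists_compact_local_stab_mul_inf W hg hW w v₀ hv₀ hC)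
    h2 (fun _ hC₀ => exists_finset_subset_box hC₀)
    (fun S κf κi hκf hκi hint => exists_GA_of_local W hW S κf κi hκf hκi hint) v₀ hv₀ hC₀

end C7LocalFibration

end Summit.Ventures.HodgeRepro.Tier4.Line1

end
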